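import Summits.QuantumFields.YangMills.Theorems.BalabanUVNodesN15KingModelPotentialDressedRateNE2

/-!
# BalabanUVNodes ∕ N15 — THE KING MODEL, PART 10e: THE CONTINUUM LIMIT AND KING'S (4.38) FOR THE TOWER FULLY DRESSED BY A POTENTIAL —
# `Δ^{(max j 1)}_v → D_v^{(∞)}`, `C_v^{(k)} → C_v^{(∞)} = (D_v^{(∞)} + aL⁻²Q*Q)⁻¹` with decay and a decay-keeping geometric tail, and
# `|C_v^{(k)} − C_v^{(k+1)}|(x,y) ≤ C·(L^{−1∕4})^k·e^{−(κ∕2)|x−y|}` with ONE constant for every volume and every coherent potential tower in the window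
# (Track A, DAG node N15 = NE2; FAN-OUT v1.1 §N15 s3 «KING-MODEL RUNG»)

HONEST FRAMING.  Count-neutral kernel bookkeeping (cell `pub-ymgap`, seat `pub-ymgap-dag-n15-d` g8; `--supports stmt-QuantumFields-20292
--as helper` = K3⁗ `SpineGivenEndpointR13Sep`; lineage K3 19676 → K3′ 19908 → K3‴ 19912).  THEOREMS ONLY (0 `def`, 0 `sorry`), standard axioms.
King's `A = 0` SCALAR tower on the King-admissible unit tori `Π ℤ∕(2L^{e+1})` (odd `L ≥ 3`, `m² > 0`) dressed NONPERTURBATIVELY by a scalar potential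
tower (`Δ^{(k)}_v`, part 9c's `kingTowerPot` = `kingTower + fullPert v`); the potential is NOT a gauge field; nothing here is Bałaban's `C^{(k)}(Λ; U)`;
`k → ∞` on a FIXED finite unit torus (King's continuum limit of the unit-lattice effective theory, §4), NOT infinite volume; NOT a node discharge;
nothing ℝ⁴ ∕ OS ∕ mass-gap ∕ Clay.
CONTENTS (part 8e's three theorems re-run on part 10d's DERIVED letters of the FULL perturbation — 8e had them for the first variation `δΔ^{(k)}[v]` only):
`dressedLeaves_fullPert` — the five leaves of `Δ_v = Δ + E(v)` at every potential tower of size `sup|v_N| ≤ w₀ ≤ w₁` and coherence defect `≤ ν₀·s^k`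
(`0 ≤ ν₀ ≤ w₁`, `0 ≤ s ≤ L^{−1∕2}`), constants UNIFORM in the volume and the potential (10d `fullPert_letters_kingU` + 8c `kingLeaves_at` + 6a
`perturbedLeaves`; the threshold `w₁ ≤ γ₀∕(8Vc₁)` keeps the gap); ★★ **`king_continuumLimit_W`** — `Δ^{(max j 1)}_v → D_v^{(∞)}` entrywise, `D_v^{(∞)} +
aL⁻²Q*Q` coercive (`≥ γ₀∕2`), `C_v^{(∞)} = (D_v^{(∞)} + aL⁻²Q*Q)⁻¹` IDENTIFIED, `C_v^{(k)}(x,y) → C_v^{(∞)}(x,y)`, `|C_v^{(∞)}(x,y)| ≤ (4∕γ₀)e^{−κ|x−y|}`,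
decay-keeping tail `C·e^{−(κ∕2)|x−y|}·(L^{−1∕4})^k∕(1 − L^{−1∕4})` (part 5's `continuumLimit_of_leaves`); ★★ **`covarianceTowerRate_fullPert`** — King's
(4.38) WITH THE POTENTIAL FULLY LIVE at every level with one constant (`CovarianceTowerRate`, b2b's `covarianceTowerRate_of_leaves`), and the same in
the cell's `T4EtaRateMin.LocalRate` currency.  The dressed covariance is written `kingCovE … (fullPert … v)` = `(kingTowerPot v j + aL⁻²Q*Q)⁻¹`
(9c `kingCovE_fullPert`).  §4 `potBgW_reg336_of_coherent` — part 9d's READ hypothesis (its sort `potBgW`'s Reg336 = the η-rate of `fullPert v`)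
HOLDS for every tower regular for part 8c's coherence sort `potBg` on King's tori (the loop 9d → 10 closed in the tree's vocabulary).
Locators: [King1986] C. King, CMP **102** (1986) 649–677: Lemma 4.3 (4.18) p. 672, (4.32)–(4.34), Lemma 4.5 (4.38), (4.39) p. 674, (4.40)–(4.41)
p. 675, pp. 675–676 (§4, A = 0 template).
-/

noncomputable section

open scoped BigOperators
open Finset Filter Topology

namespace Summit.QuantumFields.YangMills.BalabanUVNodes.N15.KingModel

open Literature.MathematicalPhysics.QuantumFieldTheory.Balaban1983to89 hiding blockOf
open Literature.MathematicalPhysics.QuantumFieldTheory.Balaban1983to89.QGQInverse (Coercive)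
open Literature.MathematicalPhysics.QuantumFieldTheory.Balaban1983to89.B4Sect5Proof (latticeConst latticeConst_nonneg)
open Literature.MathematicalPhysics.QuantumFieldTheory.Balaban1983to89.B5Prop11Plancherel (Tor fine)
open Literature.MathematicalPhysics.QuantumFieldTheory.King1986.Torus (tdistT tdistT_isPseudoDist tdistT_sumBound aminL aminL_pos CDelU CDelU_pos
  gam0L gam0L_pos kapCT kapCT_pos_le thetaBar)
open Literature.MathematicalPhysics.QuantumFieldTheory.Balaban1983to89.T4EtaRateMin (LocalRate)
open Summit.QuantumFields.BalabanUV.T4Continuum.NE2KingTransplant (IsPseudoMetric UniformCoercive UniformCTBound UniformKernelDecay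
  EffectiveOperatorSupRate VolumeSum CovarianceTowerRate covarianceTowerRate_of_leaves covTowerReadings localRate_of_covarianceTowerRate)
open Summit.QuantumFields.YangMills.BalabanUVNodes.N15KingModelRung.Curved (underPtN)

variable {d : ℕ}

section Limit

open Real

variable (L : ℕ) [NeZero L]

/-- **THE FIVE LEAVES OF THE FULLY DRESSED TOWER `Δ_v = Δ + E(v)` WITH CONSTANTS UNIFORM IN THE VOLUME AND THE POTENTIAL** (odd `L ≥ 3`,
`a, m² > 0`): there are `κ, c₁, V, w₁ > 0` such that for every volume exponent `e` and every potential tower `v` of size `sup|v_N| ≤ w₀ ≤ w₁` with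
coherence defect `≤ ν₀·s^k` (`0 ≤ ν₀ ≤ w₁`, `0 ≤ s ≤ L^{−1∕2}`), the tower `kingTower + fullPert v` (= part 9c's `kingTowerPot v`) with the block term
`aL⁻²Q*Q` carries the socket's five leaves with the constants `(γ₀ − w₀c₁V, κ, ρ + w₀c₁V, ρ_B, C_U + w₀c₁, θ̄a + c₁(w₀ + ν₀), L^{−1∕2}, V)` and
`w₁c₁V ≤ γ₀∕8` (so the gap survives) — part 10d `fullPert_letters_kingU` + 8c `kingLeaves_at` + 6a `perturbedLeaves`.
[cite: King1986, (4.33)–(4.34) p.674, Lemma 4.3 (4.18) p.672, (4.41) p.675 (the undressed leaves, A = 0)] -/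
theorem dressedLeaves_fullPert (hLodd : Odd L) (hL : 2 ≤ L) {a m2 : ℝ} (ha : 0 < a) (hm : 0 < m2) :
    ∃ κ c₁ V w₁ : ℝ, 0 < κ ∧ 0 < c₁ ∧ 0 < V ∧ 0 < w₁ ∧ w₁ * c₁ * V ≤ gam0L (d + 1) a L / 8 ∧
      ∀ (e : ℕ) (v : ∀ N : ℕ, Tor (fine N (kingU d L e)) → ℝ) (w₀ ν₀ s : ℝ),
      0 ≤ ν₀ → ν₀ ≤ w₁ → 0 ≤ s → s ≤ (L : ℝ) ^ (-(1 / 2 : ℝ)) →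
      (∀ (N : ℕ) (x : Tor (fine N (kingU d L e))), |v N x| ≤ w₀) → w₀ ≤ w₁ →
      (∀ (k : ℕ), 1 ≤ k → ∀ x' : Tor (fine (L ^ 1 * L ^ k) (kingU d L e)),
          |v (L ^ 1 * L ^ k) x' - v (L ^ k) (underPtN L k 1 (kingU d L e) x')| ≤ ν₀ * s ^ k) →
      UniformCoercive (kingTower a m2 L (kingM d L e) + fullPert a m2 L (kingM d L e) v) (kingBlock a L (kingM d L e))
          (gam0L (d + 1) a L - w₀ * c₁ * V) ∧
        UniformCTBound (kingTower a m2 L (kingM d L e) + fullPert a m2 L (kingM d L e) v) (kingBlock a L (kingM d L e))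
          (tdistT (kingU d L e)) κ (kingRho (d + 1) a L + w₀ * c₁ * V) (kingRhoB (d + 1) a L) ∧
        UniformKernelDecay (kingTower a m2 L (kingM d L e) + fullPert a m2 L (kingM d L e) v) (tdistT (kingU d L e))
          (CDelU (d + 1) a (aminL a L) + w₀ * c₁) κ ∧
        EffectiveOperatorSupRate (kingTower a m2 L (kingM d L e) + fullPert a m2 L (kingM d L e) v)
          (thetaBar a L * a + c₁ * (w₀ + ν₀)) ((L : ℝ) ^ (-(1 / 2 : ℝ))) ∧
        VolumeSum (tdistT (kingU d L e)) κ V := by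
  obtain ⟨c₁, w₁, hc₁, hw₁, HL⟩ := fullPert_letters_kingU (d := d) L hLodd hL ha hm
  obtain ⟨-, -, hr2⟩ := rate_facts L hL
  obtain ⟨hκ'0, -⟩ := kapCT_pos_le (d := d + 1) ha hL
  have hγ := gam0L_pos (d := d + 1) ha hL
  set κ₈ : ℝ := kapCT (d + 1) a L with hκ₈
  set V₈ : ℝ := latticeConst (d + 1) (κ₈ / 2) with hV₈
  have hV : 0 < V₈ := latticeConst_pos (d + 1) (half_pos hκ'0)
  set w₂ : ℝ := min w₁ (gam0L (d + 1) a L / (8 * V₈ * c₁)) with hw₂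
  have hw₂0 : 0 < w₂ := lt_min hw₁ (by positivity)
  have hw₂1 : w₂ ≤ w₁ := min_le_left _ _
  have hw₂2 : w₂ * c₁ * V₈ ≤ gam0L (d + 1) a L / 8 := by
    have h1 : w₂ ≤ gam0L (d + 1) a L / (8 * V₈ * c₁) := min_le_right _ _
    rw [le_div_iff₀ (by positivity)] at h1
    rw [le_div_iff₀ (by norm_num : (0 : ℝ) < 8)]
    linarith
  refine ⟨κ₈, c₁, V₈, w₂, hκ'0, hc₁, hV, hw₂0, hw₂2, ?_⟩
  intro e v w₀ ν₀ s hν0 hν1 hs0 hs1 hsize hw hcoh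
  have hw0 : 0 ≤ w₀ := (abs_nonneg _).trans (hsize 1 (fun μ => 0))
  obtain ⟨g1, g2, g2', g3, g4⟩ := kingLeaves_at L ha hm hL (kingM d L e) hκ'0 le_rfl hr2
  obtain ⟨l1, l2'⟩ := HL e v w₀ hsize (hw.trans hw₂1)
  have l2 := l2' ν₀ s hν0 hs0 hs1 hcoh
  exact perturbedLeaves (isPseudoMetric_tdistT (kingU d L e)) hκ'0.le (by positivity) g1 g2 g2' g3 g4 l1 l2

/-- **THE CONTINUUM LIMIT OF KING'S TOWER FULLY DRESSED BY A BOUNDED, COHERENT POTENTIAL TOWER** (`Δ^{(k)}_v`, no first-order truncation).  For odd `L ≥ 3`,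
`a, m² > 0` there are `κ, w₁, C > 0` such that for every volume exponent `e` and every potential tower `v` with `sup|v_N| ≤ w₀ ≤ w₁` and coherence
defect `≤ ν₀·s^k` (`0 ≤ ν₀ ≤ w₁`, `0 ≤ s ≤ L^{−1∕2}`) there are matrices `D_v^{(∞)}`, `C_v^{(∞)}` on the unit torus with:
`Δ^{(max j 1)} + E_j(v) → D_v^{(∞)}` entrywise; `D_v^{(∞)} + aL⁻²Q*Q` coercive with constant `γ₀∕2`; `(D_v^{(∞)} + aL⁻²Q*Q)·C_v^{(∞)} = 1` and
`C_v^{(∞)} = (D_v^{(∞)} + aL⁻²Q*Q)⁻¹`; `C_{E(v)}^{(k)}(x,y) → C_v^{(∞)}(x,y)`; `|C_v^{(∞)}(x,y)| ≤ (4∕γ₀)·e^{−κ|x−y|}`; and the decay-keeping geometric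
tail `|C_{E(v)}^{(k)}(x,y) − C_v^{(∞)}(x,y)| ≤ C·e^{−(κ∕2)|x−y|}·(L^{−1∕4})^k∕(1 − L^{−1∕4})` — part 5's `continuumLimit_of_leaves` on the DERIVED
leaves of the FULL dressing (`dressedLeaves_fullPert`). [cite: King1986, Lemma 4.5 (4.38) p.674, §4 pp.675–676 (A = 0 template)] -/
theorem king_continuumLimit_W (hLodd : Odd L) (hL : 2 ≤ L) {a m2 : ℝ} (ha : 0 < a) (hm : 0 < m2) :
    ∃ κ w₁ C : ℝ, 0 < κ ∧ 0 < w₁ ∧ 0 < C ∧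
      ∀ (e : ℕ) (v : ∀ N : ℕ, Tor (fine N (kingU d L e)) → ℝ) (w₀ ν₀ s : ℝ),
      0 ≤ ν₀ → ν₀ ≤ w₁ → 0 ≤ s → s ≤ (L : ℝ) ^ (-(1 / 2 : ℝ)) →
      (∀ (N : ℕ) (x : Tor (fine N (kingU d L e))), |v N x| ≤ w₀) → w₀ ≤ w₁ →
      (∀ (k : ℕ), 1 ≤ k → ∀ x' : Tor (fine (L ^ 1 * L ^ k) (kingU d L e)),
          |v (L ^ 1 * L ^ k) x' - v (L ^ k) (underPtN L k 1 (kingU d L e) x')| ≤ ν₀ * s ^ k) →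
      ∃ Dinf Cinf : Matrix (Tor (kingU d L e)) (Tor (kingU d L e)) ℝ,
        (∀ z w, Tendsto (fun k => (kingTower a m2 L (kingM d L e) k + fullPert a m2 L (kingM d L e) v k) z w) atTop (𝓝 (Dinf z w))) ∧
        Coercive (Dinf + kingBlock a L (kingM d L e)) (gam0L (d + 1) a L / 2) ∧
        (Dinf + kingBlock a L (kingM d L e)) * Cinf = 1 ∧ Cinf = (Dinf + kingBlock a L (kingM d L e))⁻¹ ∧
        (∀ x y, Tendsto (fun k => kingCovE a m2 L (kingM d L e) (fullPert a m2 L (kingM d L e) v) k x y) atTop (𝓝 (Cinf x y))) ∧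
        (∀ x y, |Cinf x y| ≤ (4 / gam0L (d + 1) a L) * Real.exp (-(κ * tdistT (kingU d L e) x y))) ∧
        (∀ k x y, |kingCovE a m2 L (kingM d L e) (fullPert a m2 L (kingM d L e) v) k x y - Cinf x y|
          ≤ C * Real.exp (-(κ / 2 * tdistT (kingU d L e) x y))
              * ((L : ℝ) ^ (-(1 / 4 : ℝ))) ^ k / (1 - (L : ℝ) ^ (-(1 / 4 : ℝ)))) := by
  obtain ⟨κ, c₁, V, w₁, hκ, hc₁, hV, hw₁, hgap8, HD⟩ := dressedLeaves_fullPert (d := d) L hLodd hL ha hm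
  obtain ⟨hr0, hr1, -⟩ := rate_facts L hL
  have hγ := gam0L_pos (d := d + 1) ha hL
  have hρ := kingRho_add_le (dd := d + 1) ha hL
  have hθ := thetaBar_mul_nonneg (a := a) ha hL
  have hCU := CDelU_pos (d := d + 1) ha (aminL_pos ha hL)
  set γ₀ := gam0L (d + 1) a L with hγ₀
  set r : ℝ := (L : ℝ) ^ (-(1 / 2 : ℝ)) with hr
  -- the uniform tail constant
  set C : ℝ := Real.sqrt ((thetaBar a L * a + c₁ * (w₁ + w₁)) * (2 * (CDelU (d + 1) a (aminL a L) + w₁ * c₁))) * (4 / γ₀) ^ 2 * V ^ 2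
    with hC
  have hsq : Real.sqrt r = (L : ℝ) ^ (-(1 / 4 : ℝ)) := by
    rw [hr, Real.sqrt_eq_rpow, ← Real.rpow_mul (Nat.cast_nonneg _)]
    norm_num
  refine ⟨κ, w₁, C + 1, hκ, hw₁, by positivity, ?_⟩
  intro e v w₀ ν₀ s hν0 hν1 hs0 hs1 hsize hw hcoh
  have hw0 : 0 ≤ w₀ := (abs_nonneg _).trans (hsize 1 (fun μ => 0))
  obtain ⟨g1, g2, g2', g3, g4⟩ := HD e v w₀ ν₀ s hν0 hν1 hs0 hs1 hsize hw hcoh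
  have hwV : w₀ * c₁ * V ≤ γ₀ / 8 := (mul_le_mul_of_nonneg_right (mul_le_mul_of_nonneg_right hw hc₁.le) hV.le).trans hgap8
  -- the gap and positivity of the dressed constants
  have hgap : kingRho (d + 1) a L + w₀ * c₁ * V + kingRhoB (d + 1) a L < γ₀ - w₀ * c₁ * V := by linarith
  have hγ' : 0 < γ₀ - w₀ * c₁ * V := by linarith
  have hε : 0 ≤ thetaBar a L * a + c₁ * (w₀ + ν₀) := by positivity
  obtain ⟨Dinf, Cinf, hD, -, hco, hone, hinv, hC', hdec, htail⟩ :=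
    continuumLimit_of_leaves (kingTower a m2 L (kingM d L e) + fullPert a m2 L (kingM d L e) v) (kingBlock a L (kingM d L e))
      (tdistT (kingU d L e)) (isPseudoMetric_tdistT (kingU d L e)) hgap hγ' hκ.le hε hr0.le hr1 g1 g2 g2' g3 g4
  have hmar : γ₀ / 4 ≤ γ₀ - w₀ * c₁ * V - (kingRho (d + 1) a L + w₀ * c₁ * V + kingRhoB (d + 1) a L) := by linarith
  have hinvle : (γ₀ - w₀ * c₁ * V - (kingRho (d + 1) a L + w₀ * c₁ * V + kingRhoB (d + 1) a L))⁻¹ ≤ 4 / γ₀ := by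
    have h2 : (γ₀ - w₀ * c₁ * V - (kingRho (d + 1) a L + w₀ * c₁ * V + kingRhoB (d + 1) a L))⁻¹ ≤ (γ₀ / 4)⁻¹ :=
      inv_anti₀ (by positivity) hmar
    rwa [inv_div] at h2
  refine ⟨Dinf, Cinf, hD, ?_, hone, hinv, ?_, fun x y => ?_, fun k x y => ?_⟩
  · exact coercive_of_le hco (by linarith)
  · intro x y
    exact hC' x y
  · refine (hdec x y).trans (mul_le_mul_of_nonneg_right hinvle (Real.exp_pos _).le)
  · have hmain := htail k x y
    rw [hsq] at hmain
    refine hmain.trans ?_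
    have hq0 : 0 < 1 - (L : ℝ) ^ (-(1 / 4 : ℝ)) := by
      have : (L : ℝ) ^ (-(1 / 4 : ℝ)) < 1 := by
        have hLr : (1 : ℝ) < L := by exact_mod_cast (by omega : 1 < L)
        exact rpow_lt_one_of_one_lt_of_neg hLr (by norm_num)
      linarith
    have hq : 0 ≤ ((L : ℝ) ^ (-(1 / 4 : ℝ))) ^ k / (1 - (L : ℝ) ^ (-(1 / 4 : ℝ))) :=
      div_nonneg (pow_nonneg (rpow_nonneg (Nat.cast_nonneg _) _) _) hq0.le
    have hE0 : 0 ≤ Real.exp (-(κ / 2 * tdistT (kingU d L e) x y)) := (Real.exp_pos _).le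
    -- compare the constants: monotone in w₀, ν₀ ≤ w₁ and the margin ≥ γ₀∕2 … ≤ 4∕γ₀ squared
    have hconst : Real.sqrt ((thetaBar a L * a + c₁ * (w₀ + ν₀)) * (2 * (CDelU (d + 1) a (aminL a L) + w₀ * c₁)))
        * ((γ₀ - w₀ * c₁ * V - (kingRho (d + 1) a L + w₀ * c₁ * V + kingRhoB (d + 1) a L))⁻¹) ^ 2 * V ^ 2 ≤ C + 1 := by
      have h1 : Real.sqrt ((thetaBar a L * a + c₁ * (w₀ + ν₀)) * (2 * (CDelU (d + 1) a (aminL a L) + w₀ * c₁)))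
          ≤ Real.sqrt ((thetaBar a L * a + c₁ * (w₁ + w₁)) * (2 * (CDelU (d + 1) a (aminL a L) + w₁ * c₁))) := by
        apply Real.sqrt_le_sqrt
        apply mul_le_mul _ _ (by positivity) (by positivity)
        · nlinarith
        · nlinarith
      have h2 : ((γ₀ - w₀ * c₁ * V - (kingRho (d + 1) a L + w₀ * c₁ * V + kingRhoB (d + 1) a L))⁻¹) ^ 2 ≤ (4 / γ₀) ^ 2 :=
        pow_le_pow_left₀ (inv_nonneg.mpr (by linarith)) hinvle 2
      calc _ ≤ Real.sqrt ((thetaBar a L * a + c₁ * (w₁ + w₁)) * (2 * (CDelU (d + 1) a (aminL a L) + w₁ * c₁))) * (4 / γ₀) ^ 2 * V ^ 2 := by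
            gcongr
        _ = C := rfl
        _ ≤ C + 1 := by linarith
    calc _ ≤ (C + 1) * Real.exp (-(κ / 2 * tdistT (kingU d L e) x y)) * ((L : ℝ) ^ (-(1 / 4 : ℝ))) ^ k / (1 - (L : ℝ) ^ (-(1 / 4 : ℝ))) := by
          rw [mul_div_assoc, mul_div_assoc]
          exact mul_le_mul_of_nonneg_right (mul_le_mul_of_nonneg_right hconst hE0) hq
      _ = _ := by ring

/-- **(4.38) WITH THE POTENTIAL FULLY LIVE, AT EVERY LEVEL, ONE CONSTANT** — King's Lemma 4.5 in the typed one-step tower form for `Δ^{(k)}_v`: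
`∃ κ w₁ C > 0`, for every volume exponent and every potential tower of size `≤ w₀ ≤ w₁` with coherence defect `≤ ν₀·s^k` (`0 ≤ ν₀ ≤ w₁`,
`0 ≤ s ≤ L^{−1∕2}`): `|C_{E(v)}^{(k)}(x,y) − C_{E(v)}^{(k+1)}(x,y)| ≤ C·(L^{−1∕4})^k·e^{−(κ∕2)|x−y|}` (`CovarianceTowerRate`, b2b's assembly
`covarianceTowerRate_of_leaves` on `dressedLeaves_fullPert`), and the same in the cell's `T4EtaRateMin.LocalRate` currency (N16's shape). [cite: King1986, Lemma 4.5 (4.38) p.674, (4.39) p.674, (4.40)–(4.41) p.675 (A = 0 template)] -/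
theorem covarianceTowerRate_fullPert (hLodd : Odd L) (hL : 2 ≤ L) {a m2 : ℝ} (ha : 0 < a) (hm : 0 < m2) :
    ∃ κ w₁ C : ℝ, 0 < κ ∧ 0 < w₁ ∧ 0 < C ∧
      ∀ (e : ℕ) (v : ∀ N : ℕ, Tor (fine N (kingU d L e)) → ℝ) (w₀ ν₀ s : ℝ),
      0 ≤ ν₀ → ν₀ ≤ w₁ → 0 ≤ s → s ≤ (L : ℝ) ^ (-(1 / 2 : ℝ)) →
      (∀ (N : ℕ) (x : Tor (fine N (kingU d L e))), |v N x| ≤ w₀) → w₀ ≤ w₁ →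
      (∀ (k : ℕ), 1 ≤ k → ∀ x' : Tor (fine (L ^ 1 * L ^ k) (kingU d L e)),
          |v (L ^ 1 * L ^ k) x' - v (L ^ k) (underPtN L k 1 (kingU d L e) x')| ≤ ν₀ * s ^ k) →
      CovarianceTowerRate (kingTower a m2 L (kingM d L e) + fullPert a m2 L (kingM d L e) v) (kingBlock a L (kingM d L e))
          (tdistT (kingU d L e)) C (κ / 2) ((L : ℝ) ^ (-(1 / 4 : ℝ))) ∧
        LocalRate (covTowerReadings (kingTower a m2 L (kingM d L e) + fullPert a m2 L (kingM d L e) v) (kingBlock a L (kingM d L e)))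
          C ((L : ℝ) ^ (-(1 / 4 : ℝ))) := by
  obtain ⟨κ, c₁, V, w₁, hκ, hc₁, hV, hw₁, hgap8, HD⟩ := dressedLeaves_fullPert (d := d) L hLodd hL ha hm
  obtain ⟨hr0, -, -⟩ := rate_facts L hL
  have hγ := gam0L_pos (d := d + 1) ha hL
  have hρ := kingRho_add_le (dd := d + 1) ha hL
  have hθ := thetaBar_mul_nonneg (a := a) ha hL
  have hCU := CDelU_pos (d := d + 1) ha (aminL_pos ha hL)
  set γ₀ := gam0L (d + 1) a L with hγ₀
  set r : ℝ := (L : ℝ) ^ (-(1 / 2 : ℝ)) with hr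
  set C : ℝ := Real.sqrt ((thetaBar a L * a + c₁ * (w₁ + w₁)) * (2 * (CDelU (d + 1) a (aminL a L) + w₁ * c₁))) * (4 / γ₀) ^ 2 * V ^ 2
    with hC
  have hsq : Real.sqrt r = (L : ℝ) ^ (-(1 / 4 : ℝ)) := by
    rw [hr, Real.sqrt_eq_rpow, ← Real.rpow_mul (Nat.cast_nonneg _)]
    norm_num
  have hq : 0 ≤ (L : ℝ) ^ (-(1 / 4 : ℝ)) := rpow_nonneg (Nat.cast_nonneg _) _
  refine ⟨κ, w₁, C + 1, hκ, hw₁, by positivity, ?_⟩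
  intro e v w₀ ν₀ s hν0 hν1 hs0 hs1 hsize hw hcoh
  have hpd := tdistT_isPseudoDist (kingU d L e)
  have hw0 : 0 ≤ w₀ := (abs_nonneg _).trans (hsize 1 (fun μ => 0))
  obtain ⟨g1, g2, g2', g3, g4⟩ := HD e v w₀ ν₀ s hν0 hν1 hs0 hs1 hsize hw hcoh
  have hwV : w₀ * c₁ * V ≤ γ₀ / 8 := (mul_le_mul_of_nonneg_right (mul_le_mul_of_nonneg_right hw hc₁.le) hV.le).trans hgap8
  have hgap : kingRho (d + 1) a L + w₀ * c₁ * V + kingRhoB (d + 1) a L < γ₀ - w₀ * c₁ * V := by linarith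
  have hε : 0 ≤ thetaBar a L * a + c₁ * (w₀ + ν₀) := by positivity
  have hroot := covarianceTowerRate_of_leaves (kingTower a m2 L (kingM d L e) + fullPert a m2 L (kingM d L e) v)
    (kingBlock a L (kingM d L e)) (tdistT (kingU d L e)) (isPseudoMetric_tdistT (kingU d L e)) hgap hκ.le hε hr0.le g1 g2 g2' g3 g4
  rw [hsq] at hroot
  have hmar : γ₀ / 4 ≤ γ₀ - w₀ * c₁ * V - (kingRho (d + 1) a L + w₀ * c₁ * V + kingRhoB (d + 1) a L) := by linarith
  have hinvle : (γ₀ - w₀ * c₁ * V - (kingRho (d + 1) a L + w₀ * c₁ * V + kingRhoB (d + 1) a L))⁻¹ ≤ 4 / γ₀ := by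
    have h2 : (γ₀ - w₀ * c₁ * V - (kingRho (d + 1) a L + w₀ * c₁ * V + kingRhoB (d + 1) a L))⁻¹ ≤ (γ₀ / 4)⁻¹ :=
      inv_anti₀ (by positivity) hmar
    rwa [inv_div] at h2
  have hconst : Real.sqrt ((thetaBar a L * a + c₁ * (w₀ + ν₀)) * (2 * (CDelU (d + 1) a (aminL a L) + w₀ * c₁)))
      * ((γ₀ - w₀ * c₁ * V - (kingRho (d + 1) a L + w₀ * c₁ * V + kingRhoB (d + 1) a L))⁻¹) ^ 2 * V ^ 2 ≤ C + 1 := by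
    have h1 : Real.sqrt ((thetaBar a L * a + c₁ * (w₀ + ν₀)) * (2 * (CDelU (d + 1) a (aminL a L) + w₀ * c₁)))
        ≤ Real.sqrt ((thetaBar a L * a + c₁ * (w₁ + w₁)) * (2 * (CDelU (d + 1) a (aminL a L) + w₁ * c₁))) := by
      apply Real.sqrt_le_sqrt
      apply mul_le_mul _ _ (by positivity) (by positivity)
      · nlinarith
      · nlinarith
    have h2 : ((γ₀ - w₀ * c₁ * V - (kingRho (d + 1) a L + w₀ * c₁ * V + kingRhoB (d + 1) a L))⁻¹) ^ 2 ≤ (4 / γ₀) ^ 2 :=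
      pow_le_pow_left₀ (inv_nonneg.mpr (by linarith)) hinvle 2
    calc _ ≤ Real.sqrt ((thetaBar a L * a + c₁ * (w₁ + w₁)) * (2 * (CDelU (d + 1) a (aminL a L) + w₁ * c₁))) * (4 / γ₀) ^ 2 * V ^ 2 := by
          gcongr
      _ = C := rfl
      _ ≤ C + 1 := by linarith
  have hrate : CovarianceTowerRate (kingTower a m2 L (kingM d L e) + fullPert a m2 L (kingM d L e) v) (kingBlock a L (kingM d L e))
      (tdistT (kingU d L e)) (C + 1) (κ / 2) ((L : ℝ) ^ (-(1 / 4 : ℝ))) := fun k x y =>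
    (hroot k x y).trans (mul_le_mul_of_nonneg_right (mul_le_mul_of_nonneg_right hconst (pow_nonneg hq _)) (Real.exp_pos _).le)
  exact ⟨hrate, localRate_of_covarianceTowerRate (by positivity) hq (by positivity) hpd.nonneg hrate⟩

end Limit

/-! ## §4 Closing the loop with part 9d: its READ letter (3.36) holds on the coherence sort -/

section Read

variable (L : ℕ) [NeZero L]

/-- **PART 9d's READ HYPOTHESIS IS DISCHARGED ON KING'S TORI**: there are `c, w₁ > 0` such that for every volume exponent `e`, every coherence rate
`0 ≤ s ≤ L^{−1∕2}` and every size `0 ≤ c₃₅α₀ ≤ w₁`, a potential tower that is (3.35)∧(3.36)-regular for part 8c's COHERENCE sort `potBg L s` (size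
`≤ c₃₅α₀`, coherence defect `≤ c₃₅α₀·s^k`) is (3.36)-regular for part 9d's sort `potBgW a m² L (L^{−1∕2})` at the size letter `(2c·c₃₅, α₀)` — i.e.
`EffectiveOperatorSupRate (fullPert v) (2c·c₃₅·α₀) (L^{−1∕2})`, the η-rate letter 9d's `ne2PlusUnit_kingW` consumed as a hypothesis.
[cite: King1986, Prop. 3.8 (3.71) p.664, Lemma 4.3 (4.18) p.672; Balaban1985BackgroundPropagators, (3.36) p.396 (slot)] -/
theorem potBgW_reg336_of_coherent (hLodd : Odd L) (hL : 2 ≤ L) {a m2 : ℝ} (ha : 0 < a) (hm : 0 < m2) :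
    ∃ c w₁ : ℝ, 0 < c ∧ 0 < w₁ ∧ ∀ (e : ℕ) (s : ℝ), 0 ≤ s → s ≤ (L : ℝ) ^ (-(1 / 2 : ℝ)) →
      ∀ (c35 α₀ : ℝ), 0 ≤ c35 * α₀ → c35 * α₀ ≤ w₁ →
      ∀ v : ∀ N : ℕ, Tor (fine N (kingU d L e)) → ℝ,
        (potBg (d := d) L s (kingU d L e)).Reg335 c35 α₀ v → (potBg (d := d) L s (kingU d L e)).Reg336 c35 α₀ v →
        (potBgW (d := d) a m2 L ((L : ℝ) ^ (-(1 / 2 : ℝ))) (kingM d L e)).Reg336 (2 * c * c35) α₀ v := by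
  obtain ⟨c, w₁, hc, hw₁, HL⟩ := fullPert_letters_kingU (d := d) L hLodd hL ha hm
  refine ⟨c, w₁, hc, hw₁, fun e s hs0 hs1 c35 α₀ hcα hw v h335 h336 => ?_⟩
  have h := (HL e v (c35 * α₀) h335 hw).2 (c35 * α₀) s hcα hs0 hs1 h336
  have e1 : c * (c35 * α₀ + c35 * α₀) = 2 * c * c35 * α₀ := by ring
  rw [e1] at h
  exact h

end Read

end Summit.QuantumFields.YangMills.BalabanUVNodes.N15.KingModel

end
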